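import Summits.Ventures.GridStability.Lyapunov.WSCC9LossySlab7495Data
import Summits.Ventures.GridStability.Lyapunov.WSCC9LossySlabCenter
import Literature.MathematicalPhysics.PowerSystems.LuriePostnikovSlabInstanceForms
import HarnessLib

/-!
# Rider «#35‴ LANE-V-7.495°» — the certificate at `u = 131/2000`, assembled by the ONE-FACT centre form
# (file 2 of 3; casts of file 1 + lane V's object identities BY NAME)

`cert : SlabCertificate WSCC9.lurieSystem` for the printed-lossy WSCC9 object of ★ #35 (`M′ =
WSCC9.lurieSystem`, directed Pai form WITH transfer conductances, printed damping), built by lit-6's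
`SlabCertificate.ofCenter` from: lane V's affine input decomposition `hB` and centre–radius weight-box
membership `hw_center` (tree 7-digit box, `WSCC9LossySlabCast` / `WSCC9LossySlabCenter`, BY NAME), THIS
rider's rational data `(P, ε, η, τ, λ, a, b)` (sos-2 `44a199a298d0bbbd`, file 1), `P − ε·1 ⪰ 0`, and the
ONE kernel fact `H ⪰ 0` of file 1 transported to `ℝ` (`h0_center`). Plus the rank-one facts
`s_k·P − C_kᵀC_k ⪰ 0` in `S`-typed form for the level (file 3). Same shape as lane V's
`WSCC9LossySlab.lean` + `WSCC9LossySlabCenter.lean` (lyap-1 / lit-6), nothing about the object re-declared.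

THREE COLUMNS. CERTIFIED (kernel): the identities and PSD facts below, about the MODEL `WSCC9.lurieSystem`.
VALIDATED: sos-2's SDP (CLARABEL) and exact checker. MODELLED: as `Models/ClassicalSwingLurie.lean` (MV-2 +
MV-P + MV-SPD + MV-h12). No sentence of this file says a grid is stable.
[cite: Pai1981, §2.16 Theorem [18] eqs. (2.63)–(2.64) and §4.7.3 eqs. (4.115)–(4.117); VuTuritsyn2017, §4.2 Lemma 1; BentalElghaouiNemirovski2009, §9.1.1 Thm 9.1.2 (a), (c)]
-/

noncomputable section

open Matrix
open Literature.MathematicalPhysics.PowerSystems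
open Literature.MathematicalPhysics.PowerSystems.LyapunovFunctionFamily
open Literature.Computation.Certificates
open Summit.Ventures.GridStability.Models
open Summit.Ventures.GridStability.Lyapunov.WSCC9LossySlab (e1 eκ e2 AQ CQ BjQ Crow ctrQ radQ ctr rad
  Bj w hB hw hw_center Bj_eq A_eq C_eq centerInput_eq)

namespace Summit.Ventures.GridStability.Lyapunov.WSCC9LossySlab7495

/-! ### The certificate data over `ℝ` -/

/-- `P` (real, typed index). -/
def P : Matrix (Fin 3 ⊕ Fin 2) (Fin 3 ⊕ Fin 2) ℝ := PQ.map (Rat.cast : ℚ → ℝ)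
/-- `τ` (real). -/
def τ (k : Fin 3 × Fin 3) : ℝ := (tauK k : ℝ)
/-- `λ` (real). -/
def lam (k : Fin 3 × Fin 3) : ℝ := (lamK k : ℝ)
/-- `a` (real). -/
def a (k : Fin 3 × Fin 3) : ℝ := (aK k : ℝ)
/-- `b` (real). -/
def b (k : Fin 3 × Fin 3) : ℝ := (bK k : ℝ)

/-! ### Cast plumbing -/

/-- `(M·N) ↦ ℝ` (plumbing). -/
private theorem map_mul' {m n o : Type*} [Fintype n] (M : Matrix m n ℚ) (N : Matrix n o ℚ) :
    (M * N).map (Rat.cast : ℚ → ℝ) = M.map (Rat.cast : ℚ → ℝ) * N.map (Rat.cast : ℚ → ℝ) :=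
  Matrix.map_mul (f := Rat.castHom ℝ)
/-- `(M+N) ↦ ℝ` (plumbing). -/
private theorem map_add' {m n : Type*} (M N : Matrix m n ℚ) :
    (M + N).map (Rat.cast : ℚ → ℝ) = M.map (Rat.cast : ℚ → ℝ) + N.map (Rat.cast : ℚ → ℝ) := by
  ext i j; simp
/-- `(M−N) ↦ ℝ` (plumbing). -/
private theorem map_sub' {m n : Type*} (M N : Matrix m n ℚ) :
    (M - N).map (Rat.cast : ℚ → ℝ) = M.map (Rat.cast : ℚ → ℝ) - N.map (Rat.cast : ℚ → ℝ) := by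
  ext i j; simp
/-- `(−M) ↦ ℝ` (plumbing). -/
private theorem map_neg' {m n : Type*} (M : Matrix m n ℚ) :
    (-M).map (Rat.cast : ℚ → ℝ) = -M.map (Rat.cast : ℚ → ℝ) := by
  ext i j; simp
/-- transpose commutes with the cast (plumbing). -/
private theorem map_transpose' {m n : Type*} (M : Matrix m n ℚ) :
    Mᵀ.map (Rat.cast : ℚ → ℝ) = (M.map (Rat.cast : ℚ → ℝ))ᵀ := rfl
/-- `diag(d) ↦ ℝ` (plumbing). -/
private theorem map_diagonal' {n : Type*} [DecidableEq n] (d : n → ℚ) :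
    (Matrix.diagonal d).map (Rat.cast : ℚ → ℝ) = Matrix.diagonal (fun i => (d i : ℝ)) :=
  Matrix.diagonal_map Rat.cast_zero
/-- `(q·1) ↦ ℝ` (plumbing). -/
private theorem map_smul_one' {n : Type*} [DecidableEq n] (q : ℚ) :
    (q • (1 : Matrix n n ℚ)).map (Rat.cast : ℚ → ℝ) = (q : ℝ) • (1 : Matrix n n ℝ) := by
  ext i j
  by_cases h : i = j
  · subst h; simp
  · simp [h]
/-- `(q·M) ↦ ℝ` (plumbing). -/
private theorem map_smul' {m n : Type*} (q : ℚ) (M : Matrix m n ℚ) :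
    (q • M).map (Rat.cast : ℚ → ℝ) = (q : ℝ) • M.map (Rat.cast : ℚ → ℝ) := by
  ext i j; simp
/-- zero ↦ zero (plumbing). -/
private theorem map_zero' {m n : Type*} : (0 : Matrix m n ℚ).map (Rat.cast : ℚ → ℝ) = 0 := by
  ext i j; simp
/-- `(Σ_j M_j) ↦ ℝ` (plumbing). -/
private theorem map_sum' {m n : Type*} {J : Type*} (s : Finset J) (M : J → Matrix m n ℚ) :
    (∑ j ∈ s, M j).map (Rat.cast : ℚ → ℝ) = ∑ j ∈ s, (M j).map (Rat.cast : ℚ → ℝ) := by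
  ext i k; simp [Matrix.sum_apply]

/-! ### `𝓛₀` and `𝓛_lin` of the object with THIS data are the casts of file 1's `ℚ` matrices -/

/-- `𝓛₀(S.A, S.C, P, η, λ, τ, a, b) = slab0Q ↦ ℝ` (this rider's `slab0Q`). -/
theorem slab0_eq :
    slabMatrix₀ WSCC9.lurieSystem.A WSCC9.lurieSystem.C P (etaQ : ℝ) lam τ a b
      = slab0Q.map (Rat.cast : ℚ → ℝ) := by
  have hd1 : Matrix.diagonal lam = (Matrix.diagonal lamK).map (Rat.cast : ℚ → ℝ) := by
    rw [map_diagonal']; rfl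
  have hd2 : Matrix.diagonal (fun k => τ k * (a k * b k))
      = (Matrix.diagonal (fun k => tauK k * (aK k * bK k))).map (Rat.cast : ℚ → ℝ) := by
    rw [map_diagonal']; congr 1; funext k; simp only [τ, a, b]; push_cast; ring
  have hd3 : Matrix.diagonal (fun k => τ k * (a k + b k) / 2)
      = (Matrix.diagonal (fun k => tauK k * (aK k + bK k) / 2)).map (Rat.cast : ℚ → ℝ) := by
    rw [map_diagonal']; congr 1; funext k; simp only [τ, a, b]; push_cast; ring
  have hd4 : Matrix.diagonal τ = (Matrix.diagonal tauK).map (Rat.cast : ℚ → ℝ) := by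
    rw [map_diagonal']; rfl
  rw [slabMatrix₀, A_eq, C_eq, hd1, hd2, hd3, hd4, P, slab0Q, Matrix.fromBlocks_map]
  simp only [map_sub', map_add', map_mul', map_transpose', map_smul_one', map_neg']

/-- `𝓛_lin(S.C, P, λ; B ↦ ℝ) = slabLinQ B ↦ ℝ` (this rider's `slabLinQ`). -/
theorem slabLin_eq (B : Matrix (Fin 3 ⊕ Fin 2) (Fin 3 × Fin 3) ℚ) :
    slabMatrixLin WSCC9.lurieSystem.C P lam (B.map (Rat.cast : ℚ → ℝ))
      = (slabLinQ B).map (Rat.cast : ℚ → ℝ) := by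
  have hd1 : Matrix.diagonal lam = (Matrix.diagonal lamK).map (Rat.cast : ℚ → ℝ) := by
    rw [map_diagonal']; rfl
  rw [slabMatrixLin, C_eq, hd1, P, slabLinQ, Matrix.fromBlocks_map]
  simp only [map_sub', map_mul', map_transpose', map_neg', map_zero']

/-! ### `P` facts -/

/-- `Pᵀ = P`. -/
theorem P_symm : Pᵀ = P := by
  ext i j
  simp only [P, PQ, Matrix.transpose_apply, Matrix.map_apply, Matrix.submatrix_apply]
  rw [Pq_symm]

/-- `P − ε·1 = (Pq − ε·1 ↦ ℝ)` reindexed. -/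
theorem P_sub_eq : P - (epsQ : ℝ) • (1 : Matrix (Fin 3 ⊕ Fin 2) (Fin 3 ⊕ Fin 2) ℝ)
    = ((Pq - epsQ • (1 : Matrix (Fin 5) (Fin 5) ℚ)).map (Rat.cast : ℚ → ℝ)).submatrix e1 e1 := by
  ext i j
  by_cases h : i = j
  · subst h; simp [P, PQ]
  · have h' : e1 i ≠ e1 j := fun he => h (e1.injective he)
    simp [P, PQ, h, h']

/-- **`P − ε·1 ⪰ 0`** (file 1's `Pe_ldl`). -/
theorem P_ge : (P - (epsQ : ℝ) • (1 : Matrix (Fin 3 ⊕ Fin 2) (Fin 3 ⊕ Fin 2) ℝ)).PosSemidef := by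
  rw [P_sub_eq]
  exact (Matrix.posSemidef_submatrix_equiv e1).2 (Pe_ldl.posSemidef (R := ℝ))

/-- `P ⪰ 0` (from `P − ε·1 ⪰ 0`, `ε > 0`). -/
theorem P_psd : P.PosSemidef := by
  have h : P = (P - (epsQ : ℝ) • (1 : Matrix (Fin 3 ⊕ Fin 2) (Fin 3 ⊕ Fin 2) ℝ))
      + (epsQ : ℝ) • (1 : Matrix (Fin 3 ⊕ Fin 2) (Fin 3 ⊕ Fin 2) ℝ) := by abel
  rw [h]
  exact P_ge.add (Matrix.PosSemidef.one.smul (by exact_mod_cast epsQ_pos.le))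

/-! ### The centre matrix of the receptacle IS `HQ ↦ ℝ`; the ONE fact `h₀` -/

/-- The radius terms are casts: `r_j • rowAbsDiag(𝓛_lin(B_j)) = (r_j • rowAbsDiag(slabLinQ B_j)) ↦ ℝ`. -/
theorem radiusTerm_eq (j : Fin 6) :
    rad j • rowAbsDiag (slabMatrixLin WSCC9.lurieSystem.C P lam (Bj j))
      = (radQ j • rowAbsDiag (slabLinQ (BjQ j))).map (Rat.cast : ℚ → ℝ) := by
  rw [rad, Bj_eq, slabLin_eq, ← rowAbsDiag_map_ratCast, map_smul']

/-- **The receptacle's centre matrix IS `HQ ↦ ℝ`.** -/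
theorem neg_slab_center_eq :
    -(slabMatrix₀ WSCC9.lurieSystem.A WSCC9.lurieSystem.C P (etaQ : ℝ) lam τ a b
        + slabMatrixLin WSCC9.lurieSystem.C P lam (0 + ∑ j, ctr j • Bj j))
      - ∑ j, rad j • rowAbsDiag (slabMatrixLin WSCC9.lurieSystem.C P lam (Bj j))
      = HQ.map (Rat.cast : ℚ → ℝ) := by
  rw [centerInput_eq, slabLin_eq, slab0_eq]
  simp_rw [radiusTerm_eq]
  rw [← map_sum', ← map_add', ← map_neg', ← map_sub', HQ]

/-- `H ⪰ 0` over `ℝ` on the receptacle's index type (file 1's `HQ_ldl`, reindexed). -/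
theorem posSemidef_HQ : (HQ.map (Rat.cast : ℚ → ℝ)).PosSemidef := by
  have h := (HQ_ldl.posSemidef (R := ℝ)).submatrix e2
  have e : ((HQ.submatrix ⇑e2.symm ⇑e2.symm).map (Rat.cast : ℚ → ℝ)).submatrix e2 e2
      = HQ.map (Rat.cast : ℚ → ℝ) := by
    ext i j; simp
  rwa [e] at h

/-- **`h₀`**: the receptacle's centre matrix minus the radius terms is `⪰ 0` — ONE kernel fact. -/
theorem h0_center :
    (-(slabMatrix₀ WSCC9.lurieSystem.A WSCC9.lurieSystem.C P (etaQ : ℝ) lam τ a b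
        + slabMatrixLin WSCC9.lurieSystem.C P lam (0 + ∑ j, ctr j • Bj j))
      - ∑ j, rad j • rowAbsDiag (slabMatrixLin WSCC9.lurieSystem.C P lam (Bj j))).PosSemidef := by
  rw [neg_slab_center_eq]
  exact posSemidef_HQ

/-! ### THE CERTIFICATE -/

/-- **THE SLAB + POPOV CERTIFICATE AT `u = 131/2000` FOR THE PRINTED-LOSSY WSCC9 OBJECT**
(`SlabCertificate WSCC9.lurieSystem`), built by lit-6's `SlabCertificate.ofCenter` from lane V's `hB`,
`hw_center`, this rider's rational data `(P, ε, η, τ, λ, a, b)` of sos-2's Λ `44a199a298d0bbbd`,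
`P − ε·1 ⪰ 0`, and the ONE kernel fact `h0_center`. MODEL: `WSCC9.lurieSystem`. No sentence says a
grid is stable. [cite: Pai1981, §2.16 Theorem [18] eqs. (2.63)–(2.64); VuTuritsyn2017, §4.2 Lemma 1; BentalElghaouiNemirovski2009, §9.1.1 Thm 9.1.2 (a), (c)] -/
def cert : SlabCertificate WSCC9.lurieSystem :=
  SlabCertificate.ofCenter WSCC9.lurieSystem (c := ctr) (r := rad) hB hw_center P (epsQ : ℝ) (etaQ : ℝ)
    τ lam a b P_symm
    (by exact_mod_cast epsQ_pos) (by exact_mod_cast etaQ_pos) P_ge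
    (fun k => by unfold τ tauK; exact_mod_cast tauQ_nonneg _)
    (fun k => by unfold lam lamK; exact_mod_cast lamQ_nonneg _)
    (fun k hk => by
      unfold a aK
      have hk' : 0 < lamQ (eκ k) := by unfold lam lamK at hk; exact_mod_cast hk
      exact_mod_cast aQ_nonneg_of_lamQ_pos _ hk')
    h0_center

/-- `cert.P = P`. -/ theorem cert_P : cert.P = P := rfl
/-- `cert.a = a`. -/ theorem cert_a : cert.a = a := rfl
/-- `cert.b = b`. -/ theorem cert_b : cert.b = b := rfl
/-- `cert.ε = ε`. -/ theorem cert_ε : cert.ε = (epsQ : ℝ) := rfl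
/-- `cert.η = η`. -/ theorem cert_η : cert.η = (etaQ : ℝ) := rfl
/-- `cert.lam = λ`. -/ theorem cert_lam : cert.lam = lam := rfl

/-! ### Rank-one facts in `S`-typed form (for the level) -/

/-- `s_k` (real, typed channel index). -/
def s (k : Fin 3 × Fin 3) : ℝ := (sQ (eκ k) : ℝ)

/-- `s_k > 0`. -/
theorem s_pos (k : Fin 3 × Fin 3) : 0 < s k := by unfold s; exact_mod_cast sQ_pos _

/-- `s_k·P − C_kᵀC_k = (Rk (3p+q) ↦ ℝ)` reindexed (lane V's `CQ_eq_Crow`). -/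
theorem rankOne_eq (k : Fin 3 × Fin 3) :
    s k • cert.P - Matrix.vecMulVec (WSCC9.lurieSystem.C k) (WSCC9.lurieSystem.C k)
      = ((Rk (eκ k)).map (Rat.cast : ℚ → ℝ)).submatrix e1 e1 := by
  ext i j
  simp [cert_P, P, PQ, Rk, s, C_eq, Matrix.vecMulVec_apply, WSCC9LossySlab.CQ_eq_Crow, Matrix.sub_apply,
    Matrix.smul_apply]

/-- **Rank-one facts** `s_k·P − C_kᵀC_k ⪰ 0` for every channel (active: file 1's `Rk_ldl`;
diagonal: `C_k = 0`, `s_k = 1`, `P ⪰ 0`). -/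
theorem rankOne (k : Fin 3 × Fin 3) :
    (s k • cert.P - Matrix.vecMulVec (WSCC9.lurieSystem.C k) (WSCC9.lurieSystem.C k)).PosSemidef := by
  by_cases hk : k.1 = k.2
  · have hC : WSCC9.lurieSystem.C k = 0 := by
      funext i
      rw [C_eq, Matrix.map_apply, WSCC9LossySlab.CQ_eq_Crow, Crow_diag k hk]; simp
    have hs : s k = 1 := by
      have hk' : k = (k.1, k.1) := by ext <;> simp [hk]
      have := (diag_data k.1).2.2
      unfold s eκ; rw [hk']; exact_mod_cast this
    rw [hC, hs, one_smul]
    simpa [cert_P] using P_psd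
  · rw [rankOne_eq]
    exact (Matrix.posSemidef_submatrix_equiv e1).2 ((Rk_ldl (eκ k) (eκ_active k hk)).posSemidef (R := ℝ))

end Summit.Ventures.GridStability.Lyapunov.WSCC9LossySlab7495

end
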